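import Summits.AtomisticToContinuum.HydrodynamicLimit.Theses.VitaliAmplitudeTransfer
import Summits.AtomisticToContinuum.HydrodynamicLimit.Theorems.VitaliAmplitudeTransferAmplitudeTransferFields
import Summits.AtomisticToContinuum.HydrodynamicLimit.Theorems.VitaliAmplitudeTransferAmplitudeTransferWeight
import Summits.AtomisticToContinuum.HydrodynamicLimit.Theorems.VitaliAmplitudeTransferAmplitudeTransferTools

/-!
# Crux `NearEquilibriumLimit` (stmt-AtomisticToContinuum-11871) — birth skeleton `Lines/birth.lean`

Route `VitaliAmplitudeTransfer`, sub-problem `HydrodynamicLimit`.  The crux B (card B1'): the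
hydrodynamic limit holds for the small-amplitude members `δ < δ₁` of an analytic one-parameter
family of local Gibbs laws issuing from GLOBAL equilibrium (constant profiles at `δ = 0`), on
bounded pre-shock windows `[0, T')`.

LINE (the route's own layer-2 plan "B1": Taylor-coefficient transfer AT `δ = 0`, real-variable
form).  Write `m_N(δ) = E_{ψ_δ^N}[∫ w dμ^emp(Φ^N_t z)]` for the time-`t` mean of a one-body
empirical observable and `e(δ)` for the matching tested Euler field of the member `δ`.

* `stub_tiltExpansion` (S1, the N-UNIFORM input; `UniformAmplitudeAnalyticity` localised at the
  equilibrium point, in power-series form): there is a radius `r ∈ (0,1]`, uniform in `t < T'` and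
  in the observable, such that every `m_N` is a power series `∑ b_{N,k} δ^k` on `[0,r)` with
  N-uniform Cauchy estimates `|b_{N,k}| r^k ≤ M` (the output of a convergent expansion of the
  tilted law `ψ_δ = e^{(N+1)δΛ+…} G / Z` around the invariant Gibbs law `G = ψ_0`; "no dynamical
  Lee–Yang zero in the disc `|δ| < r` before `T'`").
* `stub_coefficientLimits` (S2, EQUILIBRIUM CUMULANT IDENTIFICATION, card B1): whenever the
  N-particle means of the density / momentum / energy observables and the tested Euler fields are
  power series in `δ` on a common `[0,r)`, the `k`-th coefficient of the former — `m_N^{(k)}(0)/k!`,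
  an equilibrium `(k+1)`-point time-displaced cumulant under the invariant law, scaled by
  `(N+1)^k` — converges to the `k`-th coefficient of the latter (`k = 0` statics + invariance,
  `k = 1` Euler-scale Landau–Placzek / Spohn (7.18), `k ≥ 2` the nonlinear Euler responses of
  ballistic macroscopic fluctuation theory).
* `stub_eulerGerm` (S3, pure PDE): the tested Euler fields `δ ↦ ∫χρ^δ_t, ∫χρ^δ_t u^δ_{t,l}, ∫χE^δ_t`
  of the LLN-matched classical family are power series in `δ` on some `[0,r')`, `r'` uniform in
  `t < T'` and `χ` (identification of the data by the proved `LocalGibbsStatics`, uniqueness of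
  classical solutions near the constant state, propagation of analyticity in the dummy variable
  `δ` for the symmetric-hyperbolic hs-Euler system, Alinhac–Métivier).
* `stub_nearEquilibriumVariance` (S4, `FieldVarianceBound` near equilibrium): CLT-size
  fluctuations `(N+1)·Var ≤ C` of one-body empirical observables at Euler times for the members
  `δ < δ₁`.

ASSEMBLY `NearEquilibriumLimit_of` (proved below, no sorry): Tannery's theorem (dominated
convergence of the series `∑ b_{N,k} δ^k` under the N-uniform Cauchy estimates of S1, with the
coefficient limits of S2 towards the germ of S3) gives convergence of the MEANS for
`δ < min(r, r')`; Bienaymé–Chebyshev with S4 turns it into convergence in probability of the five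
scalar observables; the union bound over momentum coordinates
(`tendstoHydroFieldsAt_of_prob_scalars`) yields `TendstoHydroFieldsAt` for every
`δ < δ₁ := min(r, r', δ₁(S4))` and every `t < T'` — the crux BY NAME.

Disproof used: none on file for this crux (no `Disproof.lean`, `ledger crux ls` empty at birth).
-/

noncomputable section

open MeasureTheory ProbabilityTheory Filter Set Topology
open scoped ENNReal

namespace Summit.AtomisticToContinuum.HydrodynamicLimit.Cruxes.NearEquilibriumLimit.Birth

open Literature.MathematicalPhysics.KineticTheory Literature.Analysis.FluidPDE
open Literature.Analysis.FunctionSpaces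
open Summit.AtomisticToContinuum.HydrodynamicLimit.Theses.VitaliAmplitudeTransfer
open Summit.AtomisticToContinuum.HydrodynamicLimit.Theorems.AmplitudeTransfer

/-- **S1 — N-uniform tilt expansion near equilibrium** (`UniformAmplitudeAnalyticity` localised at
`δ = 0`, power-series form with N-uniform Cauchy estimates). -/
theorem stub_tiltExpansion :
    ∀ B : ℝ, 1 ≤ B → ∃ σ₀ : ℝ, 0 < σ₀ ∧ ∀ σ : ℝ, 0 < σ → σ < σ₀ →
      ∀ (a θp : ℝ → Literature.MathematicalPhysics.KineticTheory.T3 → ℝ)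
        (up : ℝ → Literature.MathematicalPhysics.KineticTheory.T3 → Literature.MathematicalPhysics.KineticTheory.V3),
        AnalyticOnNhd ℝ (Literature.Analysis.FunctionSpaces.Torus.stLift a) (Set.Icc 0 1 ×ˢ Set.univ) →
        AnalyticOnNhd ℝ (Literature.Analysis.FunctionSpaces.Torus.stLift θp) (Set.Icc 0 1 ×ˢ Set.univ) →
        AnalyticOnNhd ℝ (Literature.Analysis.FunctionSpaces.Torus.stLift up) (Set.Icc 0 1 ×ˢ Set.univ) →
        (∀ δ ∈ Set.Icc (0:ℝ) 1, ∀ x, B⁻¹ ≤ a δ x ∧ a δ x ≤ B ∧ B⁻¹ ≤ θp δ x ∧ θp δ x ≤ B ∧ ‖up δ x‖ ≤ B) →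
        (∀ x y, a 0 x = a 0 y ∧ θp 0 x = θp 0 y ∧ up 0 x = up 0 y) →
        ∀ (T' : ℝ) (ρE θE : ℝ → ℝ → Literature.MathematicalPhysics.KineticTheory.T3 → ℝ)
          (uE : ℝ → ℝ → Literature.MathematicalPhysics.KineticTheory.T3 → Literature.MathematicalPhysics.KineticTheory.V3),
          (∀ δ ∈ Set.Icc (0:ℝ) 1, Literature.MathematicalPhysics.KineticTheory.IsHardSphereEulerSolution σ T' (ρE δ) (uE δ) (θE δ)) →
          ∀ Φ : (N : ℕ) → Literature.Analysis.FluidPDE.HardSphereFlow (Literature.Analysis.FluidPDE.Torus.geometry (Fin 3)) (Literature.MathematicalPhysics.KineticTheory.hsDiameter σ N) (N + 1),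
            (∀ δ ∈ Set.Icc (0:ℝ) 1,
              (∀ N, MeasureTheory.IsProbabilityMeasure (Literature.MathematicalPhysics.KineticTheory.localGibbsLaw σ (a δ) (up δ) (θp δ) N (Φ N))) ∧
              Literature.MathematicalPhysics.KineticTheory.TendstoHydroFieldsAt (fun N => Literature.MathematicalPhysics.KineticTheory.localGibbsLaw σ (a δ) (up δ) (θp δ) N (Φ N)) Φ (ρE δ) (uE δ) (θE δ) 0) →
            ∃ r : ℝ, 0 < r ∧ r ≤ 1 ∧ ∀ t ∈ Set.Ico 0 T', ∀ w : Literature.MathematicalPhysics.KineticTheory.T3 × Literature.MathematicalPhysics.KineticTheory.V3 → ℝ, Continuous w →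
              (∃ Cw : ℝ, ∀ y, |w y| ≤ Cw * (1 + ‖y.2‖ ^ 2)) →
              ∃ M : ℝ, ∀ N : ℕ, ∃ b : ℕ → ℝ, (∀ k : ℕ, |b k| * r ^ k ≤ M) ∧
                ∀ δ ∈ Set.Ico (0:ℝ) r,
                  HasSum (fun k : ℕ => b k * δ ^ k) (∫ z, (∫ y, w y ∂(Literature.Analysis.FluidPDE.empiricalMeasure ((Φ N).flow t z))) ∂(Literature.MathematicalPhysics.KineticTheory.localGibbsLaw σ (a δ) (up δ) (θp δ) N (Φ N))) := by
  sorry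

/-- **S2 — equilibrium cumulant identification** (card B1): the Taylor coefficients at `δ = 0` of
the N-particle means of the density, momentum and energy observables converge to those of the
tested Euler fields. -/
theorem stub_coefficientLimits :
    ∀ B : ℝ, 1 ≤ B → ∃ σ₀ : ℝ, 0 < σ₀ ∧ ∀ σ : ℝ, 0 < σ → σ < σ₀ →
      ∀ (a θp : ℝ → Literature.MathematicalPhysics.KineticTheory.T3 → ℝ)
        (up : ℝ → Literature.MathematicalPhysics.KineticTheory.T3 → Literature.MathematicalPhysics.KineticTheory.V3),
        AnalyticOnNhd ℝ (Literature.Analysis.FunctionSpaces.Torus.stLift a) (Set.Icc 0 1 ×ˢ Set.univ) →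
        AnalyticOnNhd ℝ (Literature.Analysis.FunctionSpaces.Torus.stLift θp) (Set.Icc 0 1 ×ˢ Set.univ) →
        AnalyticOnNhd ℝ (Literature.Analysis.FunctionSpaces.Torus.stLift up) (Set.Icc 0 1 ×ˢ Set.univ) →
        (∀ δ ∈ Set.Icc (0:ℝ) 1, ∀ x, B⁻¹ ≤ a δ x ∧ a δ x ≤ B ∧ B⁻¹ ≤ θp δ x ∧ θp δ x ≤ B ∧ ‖up δ x‖ ≤ B) →
        (∀ x y, a 0 x = a 0 y ∧ θp 0 x = θp 0 y ∧ up 0 x = up 0 y) →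
        ∀ (T' : ℝ) (ρE θE : ℝ → ℝ → Literature.MathematicalPhysics.KineticTheory.T3 → ℝ)
          (uE : ℝ → ℝ → Literature.MathematicalPhysics.KineticTheory.T3 → Literature.MathematicalPhysics.KineticTheory.V3),
          (∀ δ ∈ Set.Icc (0:ℝ) 1, Literature.MathematicalPhysics.KineticTheory.IsHardSphereEulerSolution σ T' (ρE δ) (uE δ) (θE δ)) →
          ∀ Φ : (N : ℕ) → Literature.Analysis.FluidPDE.HardSphereFlow (Literature.Analysis.FluidPDE.Torus.geometry (Fin 3)) (Literature.MathematicalPhysics.KineticTheory.hsDiameter σ N) (N + 1),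
            (∀ δ ∈ Set.Icc (0:ℝ) 1,
              (∀ N, MeasureTheory.IsProbabilityMeasure (Literature.MathematicalPhysics.KineticTheory.localGibbsLaw σ (a δ) (up δ) (θp δ) N (Φ N))) ∧
              Literature.MathematicalPhysics.KineticTheory.TendstoHydroFieldsAt (fun N => Literature.MathematicalPhysics.KineticTheory.localGibbsLaw σ (a δ) (up δ) (θp δ) N (Φ N)) Φ (ρE δ) (uE δ) (θE δ) 0) →
            ∀ t ∈ Set.Ico 0 T', ∀ χ : Literature.MathematicalPhysics.KineticTheory.T3 → ℝ, Continuous χ →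
              (∀ r : ℝ, 0 < r → r ≤ 1 → ∀ (b : ℕ → ℕ → ℝ) (c : ℕ → ℝ),
                (∀ N : ℕ, ∀ δ ∈ Set.Ico (0:ℝ) r, HasSum (fun k : ℕ => b N k * δ ^ k) (∫ z, (∫ y, χ y.1 ∂(Literature.Analysis.FluidPDE.empiricalMeasure ((Φ N).flow t z))) ∂(Literature.MathematicalPhysics.KineticTheory.localGibbsLaw σ (a δ) (up δ) (θp δ) N (Φ N)))) →
                (∀ δ ∈ Set.Ico (0:ℝ) r, HasSum (fun k : ℕ => c k * δ ^ k) (∫ x, χ x * ρE δ t x)) →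
                ∀ k : ℕ, Filter.Tendsto (fun N : ℕ => b N k) Filter.atTop (nhds (c k))) ∧
              (∀ l : Fin 3,
                (∀ r : ℝ, 0 < r → r ≤ 1 → ∀ (b : ℕ → ℕ → ℝ) (c : ℕ → ℝ),
                  (∀ N : ℕ, ∀ δ ∈ Set.Ico (0:ℝ) r, HasSum (fun k : ℕ => b N k * δ ^ k) (∫ z, (∫ y, χ y.1 * y.2 l ∂(Literature.Analysis.FluidPDE.empiricalMeasure ((Φ N).flow t z))) ∂(Literature.MathematicalPhysics.KineticTheory.localGibbsLaw σ (a δ) (up δ) (θp δ) N (Φ N)))) →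
                  (∀ δ ∈ Set.Ico (0:ℝ) r, HasSum (fun k : ℕ => c k * δ ^ k) (∫ x, χ x * ρE δ t x * uE δ t x l)) →
                  ∀ k : ℕ, Filter.Tendsto (fun N : ℕ => b N k) Filter.atTop (nhds (c k)))) ∧
              (∀ r : ℝ, 0 < r → r ≤ 1 → ∀ (b : ℕ → ℕ → ℝ) (c : ℕ → ℝ),
                (∀ N : ℕ, ∀ δ ∈ Set.Ico (0:ℝ) r, HasSum (fun k : ℕ => b N k * δ ^ k) (∫ z, (∫ y, χ y.1 * (‖y.2‖ ^ 2 / 2) ∂(Literature.Analysis.FluidPDE.empiricalMeasure ((Φ N).flow t z))) ∂(Literature.MathematicalPhysics.KineticTheory.localGibbsLaw σ (a δ) (up δ) (θp δ) N (Φ N)))) →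
                (∀ δ ∈ Set.Ico (0:ℝ) r, HasSum (fun k : ℕ => c k * δ ^ k) (∫ x, χ x * Literature.MathematicalPhysics.KineticTheory.totalEnergyDensity (ρE δ t x) (uE δ t x) (θE δ t x))) →
                ∀ k : ℕ, Filter.Tendsto (fun N : ℕ => b N k) Filter.atTop (nhds (c k))) := by
  sorry

/-- **S3 — the Euler germ** (pure PDE): the tested Euler fields of the LLN-matched classical family
are power series in the amplitude on a uniform `[0,r')`. -/
theorem stub_eulerGerm :
    ∀ B : ℝ, 1 ≤ B → ∃ σ₀ : ℝ, 0 < σ₀ ∧ ∀ σ : ℝ, 0 < σ → σ < σ₀ →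
      ∀ (a θp : ℝ → Literature.MathematicalPhysics.KineticTheory.T3 → ℝ)
        (up : ℝ → Literature.MathematicalPhysics.KineticTheory.T3 → Literature.MathematicalPhysics.KineticTheory.V3),
        AnalyticOnNhd ℝ (Literature.Analysis.FunctionSpaces.Torus.stLift a) (Set.Icc 0 1 ×ˢ Set.univ) →
        AnalyticOnNhd ℝ (Literature.Analysis.FunctionSpaces.Torus.stLift θp) (Set.Icc 0 1 ×ˢ Set.univ) →
        AnalyticOnNhd ℝ (Literature.Analysis.FunctionSpaces.Torus.stLift up) (Set.Icc 0 1 ×ˢ Set.univ) →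
        (∀ δ ∈ Set.Icc (0:ℝ) 1, ∀ x, B⁻¹ ≤ a δ x ∧ a δ x ≤ B ∧ B⁻¹ ≤ θp δ x ∧ θp δ x ≤ B ∧ ‖up δ x‖ ≤ B) →
        (∀ x y, a 0 x = a 0 y ∧ θp 0 x = θp 0 y ∧ up 0 x = up 0 y) →
        ∀ (T' : ℝ) (ρE θE : ℝ → ℝ → Literature.MathematicalPhysics.KineticTheory.T3 → ℝ)
          (uE : ℝ → ℝ → Literature.MathematicalPhysics.KineticTheory.T3 → Literature.MathematicalPhysics.KineticTheory.V3),
          (∀ δ ∈ Set.Icc (0:ℝ) 1, Literature.MathematicalPhysics.KineticTheory.IsHardSphereEulerSolution σ T' (ρE δ) (uE δ) (θE δ)) →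
          ∀ Φ : (N : ℕ) → Literature.Analysis.FluidPDE.HardSphereFlow (Literature.Analysis.FluidPDE.Torus.geometry (Fin 3)) (Literature.MathematicalPhysics.KineticTheory.hsDiameter σ N) (N + 1),
            (∀ δ ∈ Set.Icc (0:ℝ) 1,
              (∀ N, MeasureTheory.IsProbabilityMeasure (Literature.MathematicalPhysics.KineticTheory.localGibbsLaw σ (a δ) (up δ) (θp δ) N (Φ N))) ∧
              Literature.MathematicalPhysics.KineticTheory.TendstoHydroFieldsAt (fun N => Literature.MathematicalPhysics.KineticTheory.localGibbsLaw σ (a δ) (up δ) (θp δ) N (Φ N)) Φ (ρE δ) (uE δ) (θE δ) 0) →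
            ∃ r' : ℝ, 0 < r' ∧ r' ≤ 1 ∧ ∀ t ∈ Set.Ico 0 T', ∀ χ : Literature.MathematicalPhysics.KineticTheory.T3 → ℝ, Continuous χ →
              (∃ c : ℕ → ℝ, ∀ δ ∈ Set.Ico (0:ℝ) r', HasSum (fun k : ℕ => c k * δ ^ k) (∫ x, χ x * ρE δ t x)) ∧
              (∀ l : Fin 3,
                (∃ c : ℕ → ℝ, ∀ δ ∈ Set.Ico (0:ℝ) r', HasSum (fun k : ℕ => c k * δ ^ k) (∫ x, χ x * ρE δ t x * uE δ t x l))) ∧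
              (∃ c : ℕ → ℝ, ∀ δ ∈ Set.Ico (0:ℝ) r', HasSum (fun k : ℕ => c k * δ ^ k) (∫ x, χ x * Literature.MathematicalPhysics.KineticTheory.totalEnergyDensity (ρE δ t x) (uE δ t x) (θE δ t x))) := by
  sorry

/-- **S4 — CLT-size fluctuations near equilibrium** (`FieldVarianceBound` for the members
`δ < δ₁`, constants allowed to depend on `δ`, `t` and the growth constant). -/
theorem stub_nearEquilibriumVariance :
    ∀ B : ℝ, 1 ≤ B → ∃ σ₀ : ℝ, 0 < σ₀ ∧ ∀ σ : ℝ, 0 < σ → σ < σ₀ →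
      ∀ (a θp : ℝ → Literature.MathematicalPhysics.KineticTheory.T3 → ℝ)
        (up : ℝ → Literature.MathematicalPhysics.KineticTheory.T3 → Literature.MathematicalPhysics.KineticTheory.V3),
        AnalyticOnNhd ℝ (Literature.Analysis.FunctionSpaces.Torus.stLift a) (Set.Icc 0 1 ×ˢ Set.univ) →
        AnalyticOnNhd ℝ (Literature.Analysis.FunctionSpaces.Torus.stLift θp) (Set.Icc 0 1 ×ˢ Set.univ) →
        AnalyticOnNhd ℝ (Literature.Analysis.FunctionSpaces.Torus.stLift up) (Set.Icc 0 1 ×ˢ Set.univ) →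
        (∀ δ ∈ Set.Icc (0:ℝ) 1, ∀ x, B⁻¹ ≤ a δ x ∧ a δ x ≤ B ∧ B⁻¹ ≤ θp δ x ∧ θp δ x ≤ B ∧ ‖up δ x‖ ≤ B) →
        (∀ x y, a 0 x = a 0 y ∧ θp 0 x = θp 0 y ∧ up 0 x = up 0 y) →
        ∀ (T' : ℝ) (ρE θE : ℝ → ℝ → Literature.MathematicalPhysics.KineticTheory.T3 → ℝ)
          (uE : ℝ → ℝ → Literature.MathematicalPhysics.KineticTheory.T3 → Literature.MathematicalPhysics.KineticTheory.V3),
          (∀ δ ∈ Set.Icc (0:ℝ) 1, Literature.MathematicalPhysics.KineticTheory.IsHardSphereEulerSolution σ T' (ρE δ) (uE δ) (θE δ)) →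
          ∀ Φ : (N : ℕ) → Literature.Analysis.FluidPDE.HardSphereFlow (Literature.Analysis.FluidPDE.Torus.geometry (Fin 3)) (Literature.MathematicalPhysics.KineticTheory.hsDiameter σ N) (N + 1),
            (∀ δ ∈ Set.Icc (0:ℝ) 1,
              (∀ N, MeasureTheory.IsProbabilityMeasure (Literature.MathematicalPhysics.KineticTheory.localGibbsLaw σ (a δ) (up δ) (θp δ) N (Φ N))) ∧
              Literature.MathematicalPhysics.KineticTheory.TendstoHydroFieldsAt (fun N => Literature.MathematicalPhysics.KineticTheory.localGibbsLaw σ (a δ) (up δ) (θp δ) N (Φ N)) Φ (ρE δ) (uE δ) (θE δ) 0) →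
            ∃ δ₁ : ℝ, 0 < δ₁ ∧ δ₁ ≤ 1 ∧ ∀ δ ∈ Set.Ico (0:ℝ) δ₁, ∀ t ∈ Set.Ico 0 T', ∀ Cw : ℝ, ∃ C : ℝ,
              ∀ w : Literature.MathematicalPhysics.KineticTheory.T3 × Literature.MathematicalPhysics.KineticTheory.V3 → ℝ, Continuous w → (∀ y, |w y| ≤ Cw * (1 + ‖y.2‖ ^ 2)) → ∀ N : ℕ,
                ((N : ENNReal) + 1) * ProbabilityTheory.evariance (fun z => ∫ y, w y ∂(Literature.Analysis.FluidPDE.empiricalMeasure ((Φ N).flow t z))) (Literature.MathematicalPhysics.KineticTheory.localGibbsLaw σ (a δ) (up δ) (θp δ) N (Φ N)) ≤ ENNReal.ofReal C := by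
  sorry

/-! ### Assembly tools (proved) -/

/-- **Tannery transfer.** Power series on `[0,r)` with uniform Cauchy estimates `|b_{N,k}| r^k ≤ M`
whose coefficients converge, converge at every `0 ≤ δ < r`. -/
theorem tendsto_of_hasSum_coeff {m : ℕ → ℝ} {e : ℝ} {b : ℕ → ℕ → ℝ} {c : ℕ → ℝ} {r M δ : ℝ}
    (hr : 0 < r) (hδ0 : 0 ≤ δ) (hδr : δ < r)
    (hbd : ∀ N k, |b N k| * r ^ k ≤ M)
    (hm : ∀ N, HasSum (fun k : ℕ => b N k * δ ^ k) (m N))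
    (he : HasSum (fun k : ℕ => c k * δ ^ k) e)
    (hlim : ∀ k : ℕ, Tendsto (fun N : ℕ => b N k) atTop (𝓝 (c k))) :
    Tendsto m atTop (𝓝 e) := by
  have hq0 : 0 ≤ δ / r := div_nonneg hδ0 hr.le
  have hq1 : δ / r < 1 := (div_lt_one hr).2 hδr
  have hbound : ∀ N k, ‖b N k * δ ^ k‖ ≤ M * (δ / r) ^ k := by
    intro N k
    have hrk : 0 < r ^ k := pow_pos hr k
    rw [Real.norm_eq_abs, abs_mul, abs_pow, abs_of_nonneg hδ0, div_pow,
      ← mul_div_assoc, le_div_iff₀ hrk]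
    calc |b N k| * δ ^ k * r ^ k = (|b N k| * r ^ k) * δ ^ k := by ring
      _ ≤ M * δ ^ k := mul_le_mul_of_nonneg_right (hbd N k) (pow_nonneg hδ0 k)
  have h := tendsto_tsum_of_dominated_convergence (f := fun N k => b N k * δ ^ k)
    (g := fun k => c k * δ ^ k) (bound := fun k => M * (δ / r) ^ k)
    ((summable_geometric_of_lt_one hq0 hq1).mul_left M)
    (fun k => (hlim k).mul_const (δ ^ k)) (Eventually.of_forall fun N k => hbound N k)
  have heq : m = fun N => ∑' k, b N k * δ ^ k := funext fun N => (hm N).tsum_eq.symm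
  rw [heq, ← he.tsum_eq]
  exact h

/-- The three growth bounds of the field observables `χ`, `χ v_l`, `χ |v|²/2`. -/
theorem growth_density {χ : T3 → ℝ} {Cχ : ℝ} (hCχ0 : 0 ≤ Cχ) (hCχ : ∀ x, |χ x| ≤ Cχ) :
    ∀ y : T3 × V3, |χ y.1| ≤ Cχ * (1 + ‖y.2‖ ^ 2) := fun y =>
  (hCχ y.1).trans (le_mul_of_one_le_right hCχ0 (by nlinarith [sq_nonneg ‖y.2‖]))

theorem growth_momentum {χ : T3 → ℝ} {Cχ : ℝ} (hCχ0 : 0 ≤ Cχ) (hCχ : ∀ x, |χ x| ≤ Cχ) (l : Fin 3) :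
    ∀ y : T3 × V3, |χ y.1 * y.2 l| ≤ Cχ * (1 + ‖y.2‖ ^ 2) := by
  intro y
  rw [abs_mul]
  have h1 : |y.2 l| ≤ ‖y.2‖ := by
    simpa [Real.norm_eq_abs] using PiLp.norm_apply_le y.2 l
  have h2 : ‖y.2‖ ≤ 1 + ‖y.2‖ ^ 2 := by nlinarith [sq_nonneg (‖y.2‖ - 1 / 2)]
  exact mul_le_mul (hCχ y.1) (h1.trans h2) (abs_nonneg _) hCχ0

theorem growth_energy {χ : T3 → ℝ} {Cχ : ℝ} (hCχ0 : 0 ≤ Cχ) (hCχ : ∀ x, |χ x| ≤ Cχ) :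
    ∀ y : T3 × V3, |χ y.1 * (‖y.2‖ ^ 2 / 2)| ≤ Cχ * (1 + ‖y.2‖ ^ 2) := by
  intro y
  have h0 := sq_nonneg ‖y.2‖
  rw [abs_mul, abs_of_nonneg (by linarith : (0 : ℝ) ≤ ‖y.2‖ ^ 2 / 2)]
  exact mul_le_mul (hCχ y.1) (by linarith) (by linarith) hCχ0

/-- **One scalar observable**: Tannery (S1 + S2 + S3 data) then Chebyshev (S4 data). -/
theorem tendsto_prob_scalar {σ : ℝ} {a θp : ℝ → T3 → ℝ} {up : ℝ → T3 → V3}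
    {Φ : (N : ℕ) → HardSphereFlow (Torus.geometry (Fin 3)) (hsDiameter σ N) (N + 1)}
    {δ t r M C : ℝ} [hP : ∀ N, IsProbabilityMeasure (localGibbsLaw σ (a δ) (up δ) (θp δ) N (Φ N))]
    {w : T3 × V3 → ℝ} (hw : Continuous w)
    (hr : 0 < r) (hδ0 : 0 ≤ δ) (hδr : δ < r) {b : ℕ → ℕ → ℝ} {c : ℕ → ℝ} {e : ℝ}
    (hbd : ∀ N k, |b N k| * r ^ k ≤ M)
    (hm : ∀ N, HasSum (fun k : ℕ => b N k * δ ^ k)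
      (∫ z, (∫ y, w y ∂(empiricalMeasure ((Φ N).flow t z))) ∂(localGibbsLaw σ (a δ) (up δ) (θp δ) N (Φ N))))
    (he : HasSum (fun k : ℕ => c k * δ ^ k) e)
    (hlim : ∀ k : ℕ, Tendsto (fun N : ℕ => b N k) atTop (𝓝 (c k)))
    (hvar : ∀ N : ℕ, ((N : ℝ≥0∞) + 1) *
      evariance (fun z => ∫ y, w y ∂(empiricalMeasure ((Φ N).flow t z)))
        (localGibbsLaw σ (a δ) (up δ) (θp δ) N (Φ N)) ≤ ENNReal.ofReal C)
    {η : ℝ} (hη : 0 < η) :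
    Tendsto (fun N => localGibbsLaw σ (a δ) (up δ) (θp δ) N (Φ N)
      {z | η < |(∫ y, w y ∂(empiricalMeasure ((Φ N).flow t z))) - e|}) atTop (𝓝 0) := by
  have hmean : Tendsto (fun N => ∫ z, (∫ y, w y ∂(empiricalMeasure ((Φ N).flow t z)))
      ∂(localGibbsLaw σ (a δ) (up δ) (θp δ) N (Φ N))) atTop (𝓝 e) :=
    tendsto_of_hasSum_coeff hr hδ0 hδr hbd hm he hlim
  exact tendsto_measure_lt_abs_sub_of_evariance_le
    (P := fun N => localGibbsLaw σ (a δ) (up δ) (θp δ) N (Φ N))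
    (X := fun N z => ∫ y, w y ∂(empiricalMeasure ((Φ N).flow t z)))
    (fun N => (measurable_integral_empiricalMeasure_flow (Φ N) hw t).aestronglyMeasurable)
    hvar hmean hη

/-! ### The assembly: the four stubs imply the crux BY NAME -/

/-- **`NearEquilibriumLimit` from S1–S4.** -/
theorem NearEquilibriumLimit_of :
    (∀ B : ℝ, 1 ≤ B → ∃ σ₀ : ℝ, 0 < σ₀ ∧ ∀ σ : ℝ, 0 < σ → σ < σ₀ →
      ∀ (a θp : ℝ → Literature.MathematicalPhysics.KineticTheory.T3 → ℝ)
        (up : ℝ → Literature.MathematicalPhysics.KineticTheory.T3 → Literature.MathematicalPhysics.KineticTheory.V3),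
        AnalyticOnNhd ℝ (Literature.Analysis.FunctionSpaces.Torus.stLift a) (Set.Icc 0 1 ×ˢ Set.univ) →
        AnalyticOnNhd ℝ (Literature.Analysis.FunctionSpaces.Torus.stLift θp) (Set.Icc 0 1 ×ˢ Set.univ) →
        AnalyticOnNhd ℝ (Literature.Analysis.FunctionSpaces.Torus.stLift up) (Set.Icc 0 1 ×ˢ Set.univ) →
        (∀ δ ∈ Set.Icc (0:ℝ) 1, ∀ x, B⁻¹ ≤ a δ x ∧ a δ x ≤ B ∧ B⁻¹ ≤ θp δ x ∧ θp δ x ≤ B ∧ ‖up δ x‖ ≤ B) →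
        (∀ x y, a 0 x = a 0 y ∧ θp 0 x = θp 0 y ∧ up 0 x = up 0 y) →
        ∀ (T' : ℝ) (ρE θE : ℝ → ℝ → Literature.MathematicalPhysics.KineticTheory.T3 → ℝ)
          (uE : ℝ → ℝ → Literature.MathematicalPhysics.KineticTheory.T3 → Literature.MathematicalPhysics.KineticTheory.V3),
          (∀ δ ∈ Set.Icc (0:ℝ) 1, Literature.MathematicalPhysics.KineticTheory.IsHardSphereEulerSolution σ T' (ρE δ) (uE δ) (θE δ)) →
          ∀ Φ : (N : ℕ) → Literature.Analysis.FluidPDE.HardSphereFlow (Literature.Analysis.FluidPDE.Torus.geometry (Fin 3)) (Literature.MathematicalPhysics.KineticTheory.hsDiameter σ N) (N + 1),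
            (∀ δ ∈ Set.Icc (0:ℝ) 1,
              (∀ N, MeasureTheory.IsProbabilityMeasure (Literature.MathematicalPhysics.KineticTheory.localGibbsLaw σ (a δ) (up δ) (θp δ) N (Φ N))) ∧
              Literature.MathematicalPhysics.KineticTheory.TendstoHydroFieldsAt (fun N => Literature.MathematicalPhysics.KineticTheory.localGibbsLaw σ (a δ) (up δ) (θp δ) N (Φ N)) Φ (ρE δ) (uE δ) (θE δ) 0) →
            ∃ r : ℝ, 0 < r ∧ r ≤ 1 ∧ ∀ t ∈ Set.Ico 0 T', ∀ w : Literature.MathematicalPhysics.KineticTheory.T3 × Literature.MathematicalPhysics.KineticTheory.V3 → ℝ, Continuous w →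
              (∃ Cw : ℝ, ∀ y, |w y| ≤ Cw * (1 + ‖y.2‖ ^ 2)) →
              ∃ M : ℝ, ∀ N : ℕ, ∃ b : ℕ → ℝ, (∀ k : ℕ, |b k| * r ^ k ≤ M) ∧
                ∀ δ ∈ Set.Ico (0:ℝ) r,
                  HasSum (fun k : ℕ => b k * δ ^ k) (∫ z, (∫ y, w y ∂(Literature.Analysis.FluidPDE.empiricalMeasure ((Φ N).flow t z))) ∂(Literature.MathematicalPhysics.KineticTheory.localGibbsLaw σ (a δ) (up δ) (θp δ) N (Φ N)))) →
    (∀ B : ℝ, 1 ≤ B → ∃ σ₀ : ℝ, 0 < σ₀ ∧ ∀ σ : ℝ, 0 < σ → σ < σ₀ →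
      ∀ (a θp : ℝ → Literature.MathematicalPhysics.KineticTheory.T3 → ℝ)
        (up : ℝ → Literature.MathematicalPhysics.KineticTheory.T3 → Literature.MathematicalPhysics.KineticTheory.V3),
        AnalyticOnNhd ℝ (Literature.Analysis.FunctionSpaces.Torus.stLift a) (Set.Icc 0 1 ×ˢ Set.univ) →
        AnalyticOnNhd ℝ (Literature.Analysis.FunctionSpaces.Torus.stLift θp) (Set.Icc 0 1 ×ˢ Set.univ) →
        AnalyticOnNhd ℝ (Literature.Analysis.FunctionSpaces.Torus.stLift up) (Set.Icc 0 1 ×ˢ Set.univ) →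
        (∀ δ ∈ Set.Icc (0:ℝ) 1, ∀ x, B⁻¹ ≤ a δ x ∧ a δ x ≤ B ∧ B⁻¹ ≤ θp δ x ∧ θp δ x ≤ B ∧ ‖up δ x‖ ≤ B) →
        (∀ x y, a 0 x = a 0 y ∧ θp 0 x = θp 0 y ∧ up 0 x = up 0 y) →
        ∀ (T' : ℝ) (ρE θE : ℝ → ℝ → Literature.MathematicalPhysics.KineticTheory.T3 → ℝ)
          (uE : ℝ → ℝ → Literature.MathematicalPhysics.KineticTheory.T3 → Literature.MathematicalPhysics.KineticTheory.V3),
          (∀ δ ∈ Set.Icc (0:ℝ) 1, Literature.MathematicalPhysics.KineticTheory.IsHardSphereEulerSolution σ T' (ρE δ) (uE δ) (θE δ)) →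
          ∀ Φ : (N : ℕ) → Literature.Analysis.FluidPDE.HardSphereFlow (Literature.Analysis.FluidPDE.Torus.geometry (Fin 3)) (Literature.MathematicalPhysics.KineticTheory.hsDiameter σ N) (N + 1),
            (∀ δ ∈ Set.Icc (0:ℝ) 1,
              (∀ N, MeasureTheory.IsProbabilityMeasure (Literature.MathematicalPhysics.KineticTheory.localGibbsLaw σ (a δ) (up δ) (θp δ) N (Φ N))) ∧
              Literature.MathematicalPhysics.KineticTheory.TendstoHydroFieldsAt (fun N => Literature.MathematicalPhysics.KineticTheory.localGibbsLaw σ (a δ) (up δ) (θp δ) N (Φ N)) Φ (ρE δ) (uE δ) (θE δ) 0) →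
            ∀ t ∈ Set.Ico 0 T', ∀ χ : Literature.MathematicalPhysics.KineticTheory.T3 → ℝ, Continuous χ →
              (∀ r : ℝ, 0 < r → r ≤ 1 → ∀ (b : ℕ → ℕ → ℝ) (c : ℕ → ℝ),
                (∀ N : ℕ, ∀ δ ∈ Set.Ico (0:ℝ) r, HasSum (fun k : ℕ => b N k * δ ^ k) (∫ z, (∫ y, χ y.1 ∂(Literature.Analysis.FluidPDE.empiricalMeasure ((Φ N).flow t z))) ∂(Literature.MathematicalPhysics.KineticTheory.localGibbsLaw σ (a δ) (up δ) (θp δ) N (Φ N)))) →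
                (∀ δ ∈ Set.Ico (0:ℝ) r, HasSum (fun k : ℕ => c k * δ ^ k) (∫ x, χ x * ρE δ t x)) →
                ∀ k : ℕ, Filter.Tendsto (fun N : ℕ => b N k) Filter.atTop (nhds (c k))) ∧
              (∀ l : Fin 3,
                (∀ r : ℝ, 0 < r → r ≤ 1 → ∀ (b : ℕ → ℕ → ℝ) (c : ℕ → ℝ),
                  (∀ N : ℕ, ∀ δ ∈ Set.Ico (0:ℝ) r, HasSum (fun k : ℕ => b N k * δ ^ k) (∫ z, (∫ y, χ y.1 * y.2 l ∂(Literature.Analysis.FluidPDE.empiricalMeasure ((Φ N).flow t z))) ∂(Literature.MathematicalPhysics.KineticTheory.localGibbsLaw σ (a δ) (up δ) (θp δ) N (Φ N)))) →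
                  (∀ δ ∈ Set.Ico (0:ℝ) r, HasSum (fun k : ℕ => c k * δ ^ k) (∫ x, χ x * ρE δ t x * uE δ t x l)) →
                  ∀ k : ℕ, Filter.Tendsto (fun N : ℕ => b N k) Filter.atTop (nhds (c k)))) ∧
              (∀ r : ℝ, 0 < r → r ≤ 1 → ∀ (b : ℕ → ℕ → ℝ) (c : ℕ → ℝ),
                (∀ N : ℕ, ∀ δ ∈ Set.Ico (0:ℝ) r, HasSum (fun k : ℕ => b N k * δ ^ k) (∫ z, (∫ y, χ y.1 * (‖y.2‖ ^ 2 / 2) ∂(Literature.Analysis.FluidPDE.empiricalMeasure ((Φ N).flow t z))) ∂(Literature.MathematicalPhysics.KineticTheory.localGibbsLaw σ (a δ) (up δ) (θp δ) N (Φ N)))) →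
                (∀ δ ∈ Set.Ico (0:ℝ) r, HasSum (fun k : ℕ => c k * δ ^ k) (∫ x, χ x * Literature.MathematicalPhysics.KineticTheory.totalEnergyDensity (ρE δ t x) (uE δ t x) (θE δ t x))) →
                ∀ k : ℕ, Filter.Tendsto (fun N : ℕ => b N k) Filter.atTop (nhds (c k)))) →
    (∀ B : ℝ, 1 ≤ B → ∃ σ₀ : ℝ, 0 < σ₀ ∧ ∀ σ : ℝ, 0 < σ → σ < σ₀ →
      ∀ (a θp : ℝ → Literature.MathematicalPhysics.KineticTheory.T3 → ℝ)
        (up : ℝ → Literature.MathematicalPhysics.KineticTheory.T3 → Literature.MathematicalPhysics.KineticTheory.V3),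
        AnalyticOnNhd ℝ (Literature.Analysis.FunctionSpaces.Torus.stLift a) (Set.Icc 0 1 ×ˢ Set.univ) →
        AnalyticOnNhd ℝ (Literature.Analysis.FunctionSpaces.Torus.stLift θp) (Set.Icc 0 1 ×ˢ Set.univ) →
        AnalyticOnNhd ℝ (Literature.Analysis.FunctionSpaces.Torus.stLift up) (Set.Icc 0 1 ×ˢ Set.univ) →
        (∀ δ ∈ Set.Icc (0:ℝ) 1, ∀ x, B⁻¹ ≤ a δ x ∧ a δ x ≤ B ∧ B⁻¹ ≤ θp δ x ∧ θp δ x ≤ B ∧ ‖up δ x‖ ≤ B) →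
        (∀ x y, a 0 x = a 0 y ∧ θp 0 x = θp 0 y ∧ up 0 x = up 0 y) →
        ∀ (T' : ℝ) (ρE θE : ℝ → ℝ → Literature.MathematicalPhysics.KineticTheory.T3 → ℝ)
          (uE : ℝ → ℝ → Literature.MathematicalPhysics.KineticTheory.T3 → Literature.MathematicalPhysics.KineticTheory.V3),
          (∀ δ ∈ Set.Icc (0:ℝ) 1, Literature.MathematicalPhysics.KineticTheory.IsHardSphereEulerSolution σ T' (ρE δ) (uE δ) (θE δ)) →
          ∀ Φ : (N : ℕ) → Literature.Analysis.FluidPDE.HardSphereFlow (Literature.Analysis.FluidPDE.Torus.geometry (Fin 3)) (Literature.MathematicalPhysics.KineticTheory.hsDiameter σ N) (N + 1),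
            (∀ δ ∈ Set.Icc (0:ℝ) 1,
              (∀ N, MeasureTheory.IsProbabilityMeasure (Literature.MathematicalPhysics.KineticTheory.localGibbsLaw σ (a δ) (up δ) (θp δ) N (Φ N))) ∧
              Literature.MathematicalPhysics.KineticTheory.TendstoHydroFieldsAt (fun N => Literature.MathematicalPhysics.KineticTheory.localGibbsLaw σ (a δ) (up δ) (θp δ) N (Φ N)) Φ (ρE δ) (uE δ) (θE δ) 0) →
            ∃ r' : ℝ, 0 < r' ∧ r' ≤ 1 ∧ ∀ t ∈ Set.Ico 0 T', ∀ χ : Literature.MathematicalPhysics.KineticTheory.T3 → ℝ, Continuous χ →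
              (∃ c : ℕ → ℝ, ∀ δ ∈ Set.Ico (0:ℝ) r', HasSum (fun k : ℕ => c k * δ ^ k) (∫ x, χ x * ρE δ t x)) ∧
              (∀ l : Fin 3,
                (∃ c : ℕ → ℝ, ∀ δ ∈ Set.Ico (0:ℝ) r', HasSum (fun k : ℕ => c k * δ ^ k) (∫ x, χ x * ρE δ t x * uE δ t x l))) ∧
              (∃ c : ℕ → ℝ, ∀ δ ∈ Set.Ico (0:ℝ) r', HasSum (fun k : ℕ => c k * δ ^ k) (∫ x, χ x * Literature.MathematicalPhysics.KineticTheory.totalEnergyDensity (ρE δ t x) (uE δ t x) (θE δ t x)))) →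
    (∀ B : ℝ, 1 ≤ B → ∃ σ₀ : ℝ, 0 < σ₀ ∧ ∀ σ : ℝ, 0 < σ → σ < σ₀ →
      ∀ (a θp : ℝ → Literature.MathematicalPhysics.KineticTheory.T3 → ℝ)
        (up : ℝ → Literature.MathematicalPhysics.KineticTheory.T3 → Literature.MathematicalPhysics.KineticTheory.V3),
        AnalyticOnNhd ℝ (Literature.Analysis.FunctionSpaces.Torus.stLift a) (Set.Icc 0 1 ×ˢ Set.univ) →
        AnalyticOnNhd ℝ (Literature.Analysis.FunctionSpaces.Torus.stLift θp) (Set.Icc 0 1 ×ˢ Set.univ) →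
        AnalyticOnNhd ℝ (Literature.Analysis.FunctionSpaces.Torus.stLift up) (Set.Icc 0 1 ×ˢ Set.univ) →
        (∀ δ ∈ Set.Icc (0:ℝ) 1, ∀ x, B⁻¹ ≤ a δ x ∧ a δ x ≤ B ∧ B⁻¹ ≤ θp δ x ∧ θp δ x ≤ B ∧ ‖up δ x‖ ≤ B) →
        (∀ x y, a 0 x = a 0 y ∧ θp 0 x = θp 0 y ∧ up 0 x = up 0 y) →
        ∀ (T' : ℝ) (ρE θE : ℝ → ℝ → Literature.MathematicalPhysics.KineticTheory.T3 → ℝ)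
          (uE : ℝ → ℝ → Literature.MathematicalPhysics.KineticTheory.T3 → Literature.MathematicalPhysics.KineticTheory.V3),
          (∀ δ ∈ Set.Icc (0:ℝ) 1, Literature.MathematicalPhysics.KineticTheory.IsHardSphereEulerSolution σ T' (ρE δ) (uE δ) (θE δ)) →
          ∀ Φ : (N : ℕ) → Literature.Analysis.FluidPDE.HardSphereFlow (Literature.Analysis.FluidPDE.Torus.geometry (Fin 3)) (Literature.MathematicalPhysics.KineticTheory.hsDiameter σ N) (N + 1),
            (∀ δ ∈ Set.Icc (0:ℝ) 1,
              (∀ N, MeasureTheory.IsProbabilityMeasure (Literature.MathematicalPhysics.KineticTheory.localGibbsLaw σ (a δ) (up δ) (θp δ) N (Φ N))) ∧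
              Literature.MathematicalPhysics.KineticTheory.TendstoHydroFieldsAt (fun N => Literature.MathematicalPhysics.KineticTheory.localGibbsLaw σ (a δ) (up δ) (θp δ) N (Φ N)) Φ (ρE δ) (uE δ) (θE δ) 0) →
            ∃ δ₁ : ℝ, 0 < δ₁ ∧ δ₁ ≤ 1 ∧ ∀ δ ∈ Set.Ico (0:ℝ) δ₁, ∀ t ∈ Set.Ico 0 T', ∀ Cw : ℝ, ∃ C : ℝ,
              ∀ w : Literature.MathematicalPhysics.KineticTheory.T3 × Literature.MathematicalPhysics.KineticTheory.V3 → ℝ, Continuous w → (∀ y, |w y| ≤ Cw * (1 + ‖y.2‖ ^ 2)) → ∀ N : ℕ,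
                ((N : ENNReal) + 1) * ProbabilityTheory.evariance (fun z => ∫ y, w y ∂(Literature.Analysis.FluidPDE.empiricalMeasure ((Φ N).flow t z))) (Literature.MathematicalPhysics.KineticTheory.localGibbsLaw σ (a δ) (up δ) (θp δ) N (Φ N)) ≤ ENNReal.ofReal C) →
    Summit.AtomisticToContinuum.HydrodynamicLimit.Theses.VitaliAmplitudeTransfer.NearEquilibriumLimit := by
  intro h1 h2 h3 h4
  intro B hB
  obtain ⟨σ₁, hσ₁, H1⟩ := h1 B hB
  obtain ⟨σ₂, hσ₂, H2⟩ := h2 B hB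
  obtain ⟨σ₃, hσ₃, H3⟩ := h3 B hB
  obtain ⟨σ₄, hσ₄, H4⟩ := h4 B hB
  refine ⟨min σ₁ (min σ₂ (min σ₃ σ₄)), lt_min hσ₁ (lt_min hσ₂ (lt_min hσ₃ hσ₄)), ?_⟩
  intro σ hσ hσlt a θp up haA hθA huA hbd hconst T' ρE θE uE hEsol Φ hP5
  have hσ1 : σ < σ₁ := lt_of_lt_of_le hσlt (min_le_left _ _)
  have hσ2 : σ < σ₂ := lt_of_lt_of_le hσlt ((min_le_right _ _).trans (min_le_left _ _))
  have hσ3 : σ < σ₃ :=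
    lt_of_lt_of_le hσlt ((min_le_right _ _).trans ((min_le_right _ _).trans (min_le_left _ _)))
  have hσ4 : σ < σ₄ :=
    lt_of_lt_of_le hσlt ((min_le_right _ _).trans ((min_le_right _ _).trans (min_le_right _ _)))
  obtain ⟨r, hr, hr1, H1'⟩ := H1 σ hσ hσ1 a θp up haA hθA huA hbd hconst T' ρE θE uE hEsol Φ hP5
  have H2' := H2 σ hσ hσ2 a θp up haA hθA huA hbd hconst T' ρE θE uE hEsol Φ hP5
  obtain ⟨r', hr', hr'1, H3'⟩ := H3 σ hσ hσ3 a θp up haA hθA huA hbd hconst T' ρE θE uE hEsol Φ hP5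
  obtain ⟨δ₄, hδ₄, hδ₄1, H4'⟩ := H4 σ hσ hσ4 a θp up haA hθA huA hbd hconst T' ρE θE uE hEsol Φ hP5
  refine ⟨min r (min r' δ₄), lt_min hr (lt_min hr' hδ₄), ?_⟩
  intro δ hδ t ht
  have hδ0 : 0 ≤ δ := hδ.1
  have hδr : δ < r := lt_of_lt_of_le hδ.2 (min_le_left _ _)
  have hδr' : δ < r' := lt_of_lt_of_le hδ.2 ((min_le_right _ _).trans (min_le_left _ _))
  have hδ4 : δ < δ₄ := lt_of_lt_of_le hδ.2 ((min_le_right _ _).trans (min_le_right _ _))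
  have hδI : δ ∈ Set.Icc (0:ℝ) 1 := ⟨hδ0, hδ4.le.trans hδ₄1⟩
  -- the common radius of S1 and S3, fed to S2
  have hr₀ : 0 < min r r' := lt_min hr hr'
  have hr₀1 : min r r' ≤ 1 := (min_le_left _ _).trans hr1
  haveI : ∀ N, IsProbabilityMeasure (localGibbsLaw σ (a δ) (up δ) (θp δ) N (Φ N)) := (hP5 δ hδI).1
  obtain ⟨hρc, huc, -⟩ := continuous_slices_of_isHardSphereEulerSolution (hEsol δ hδI) ht
  -- S4 at `(δ, t)`, S2 and S3 at `t`
  have hV := H4' δ ⟨hδ0, hδ4⟩ t ht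
  refine tendstoHydroFieldsAt_of_prob_scalars hρc huc (fun χ hχ η hη => ?_)
    (fun χ hχ l η hη => ?_) (fun χ hχ η hη => ?_)
  · -- density observable `χ(x)`
    obtain ⟨Cχ, hCχ0, hCχ⟩ := exists_forall_abs_le_of_continuous hχ
    have hw : Continuous fun y : T3 × V3 => χ y.1 := hχ.comp continuous_fst
    have hwb := growth_density hCχ0 hCχ
    obtain ⟨M, hM⟩ := H1' t ht (fun y => χ y.1) hw ⟨Cχ, hwb⟩
    choose b hb using hM
    obtain ⟨⟨c, hc⟩, -, -⟩ := H3' t ht χ hχ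
    obtain ⟨hcoefD, -, -⟩ := H2' t ht χ hχ
    have hlim : ∀ k : ℕ, Tendsto (fun N : ℕ => b N k) atTop (𝓝 (c k)) :=
      hcoefD (min r r') hr₀ hr₀1 b c
        (fun N δ' hδ' => (hb N).2 δ' ⟨hδ'.1, lt_of_lt_of_le hδ'.2 (min_le_left _ _)⟩)
        (fun δ' hδ' => hc δ' ⟨hδ'.1, lt_of_lt_of_le hδ'.2 (min_le_right _ _)⟩)
    obtain ⟨C, hC⟩ := hV Cχ
    exact tendsto_prob_scalar hw hr hδ0 hδr (fun N k => (hb N).1 k)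
      (fun N => (hb N).2 δ ⟨hδ0, hδr⟩) (hc δ ⟨hδ0, hδr'⟩) hlim
      (fun N => hC _ hw hwb N) hη
  · -- momentum observable `χ(x) v_l`
    obtain ⟨Cχ, hCχ0, hCχ⟩ := exists_forall_abs_le_of_continuous hχ
    have hw : Continuous fun y : T3 × V3 => χ y.1 * y.2 l :=
      (hχ.comp continuous_fst).mul ((EuclideanSpace.proj (𝕜 := ℝ) l).continuous.comp continuous_snd)
    have hwb := growth_momentum hCχ0 hCχ l
    obtain ⟨M, hM⟩ := H1' t ht (fun y => χ y.1 * y.2 l) hw ⟨Cχ, hwb⟩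
    choose b hb using hM
    obtain ⟨-, hcM, -⟩ := H3' t ht χ hχ
    obtain ⟨c, hc⟩ := hcM l
    obtain ⟨-, hcoefM, -⟩ := H2' t ht χ hχ
    have hlim : ∀ k : ℕ, Tendsto (fun N : ℕ => b N k) atTop (𝓝 (c k)) :=
      hcoefM l (min r r') hr₀ hr₀1 b c
        (fun N δ' hδ' => (hb N).2 δ' ⟨hδ'.1, lt_of_lt_of_le hδ'.2 (min_le_left _ _)⟩)
        (fun δ' hδ' => hc δ' ⟨hδ'.1, lt_of_lt_of_le hδ'.2 (min_le_right _ _)⟩)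
    obtain ⟨C, hC⟩ := hV Cχ
    exact tendsto_prob_scalar hw hr hδ0 hδr (fun N k => (hb N).1 k)
      (fun N => (hb N).2 δ ⟨hδ0, hδr⟩) (hc δ ⟨hδ0, hδr'⟩) hlim
      (fun N => hC _ hw hwb N) hη
  · -- energy observable `χ(x) |v|²/2`
    obtain ⟨Cχ, hCχ0, hCχ⟩ := exists_forall_abs_le_of_continuous hχ
    have hw : Continuous fun y : T3 × V3 => χ y.1 * (‖y.2‖ ^ 2 / 2) :=
      (hχ.comp continuous_fst).mul ((continuous_snd.norm.pow 2).div_const 2)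
    have hwb := growth_energy hCχ0 hCχ
    obtain ⟨M, hM⟩ := H1' t ht (fun y => χ y.1 * (‖y.2‖ ^ 2 / 2)) hw ⟨Cχ, hwb⟩
    choose b hb using hM
    obtain ⟨-, -, c, hc⟩ := H3' t ht χ hχ
    obtain ⟨-, -, hcoefE⟩ := H2' t ht χ hχ
    have hlim : ∀ k : ℕ, Tendsto (fun N : ℕ => b N k) atTop (𝓝 (c k)) :=
      hcoefE (min r r') hr₀ hr₀1 b c
        (fun N δ' hδ' => (hb N).2 δ' ⟨hδ'.1, lt_of_lt_of_le hδ'.2 (min_le_left _ _)⟩)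
        (fun δ' hδ' => hc δ' ⟨hδ'.1, lt_of_lt_of_le hδ'.2 (min_le_right _ _)⟩)
    obtain ⟨C, hC⟩ := hV Cχ
    exact tendsto_prob_scalar hw hr hδ0 hδr (fun N k => (hb N).1 k)
      (fun N => (hb N).2 δ ⟨hδ0, hδr⟩) (hc δ ⟨hδ0, hδr'⟩) hlim
      (fun N => hC _ hw hwb N) hη

/-- Stub form of the assembly (the registered composition). -/
theorem NearEquilibriumLimit_of_stubs :
    Summit.AtomisticToContinuum.HydrodynamicLimit.Theses.VitaliAmplitudeTransfer.NearEquilibriumLimit :=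
  NearEquilibriumLimit_of stub_tiltExpansion stub_coefficientLimits stub_eulerGerm
    stub_nearEquilibriumVariance

end Summit.AtomisticToContinuum.HydrodynamicLimit.Cruxes.NearEquilibriumLimit.Birth

end
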